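import Literature.NumberTheory.EllipticCurves.AnalyticRankOrderProofs
import Literature.NumberTheory.EllipticCurves.BSDQuadraticDescentProofs
import HarnessLib

/-!
# Leading Taylor coefficients multiply: `L^*(E_K, 1) = L^*(E, 1) · L^*(E^{(D)}, 1)`

HONEST FRAMING (cell `b2b-bsdres`, run/shared/lean/b2b/bsd-rank1-residual/, verbatim in every
file): the goal of the cell is to DELETE the COMBINATION-SHAPED residual classes of the
Birch–Swinnerton-Dyer formula for ALL analytic-rank `≤ 1` elliptic curves over `ℚ` — "full BSD
formula for every rank `≤ 1` curve in class `C`" assembled STRICTLY from published theorems — so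
that the rank-`≤ 1` remainder becomes exactly the CONSTRUCTION-SHAPED classes, which are TYPED
(missing-input `Prop`s), NOT attempted. This is not "finishing BSD". Sub-cell
`b2b-bsdres-additive-p1` (X3/X4 at an additive, potentially multiplicative prime; research route,
no claim beyond the stated sub-classes).

Pure complex analysis + the tree's Artin formalism, needed by the base-change-and-descend route
(`AdditivePotMult/Descent.lean`): for functions `f, g` analytic at `c` and not identically zero
near `c`, the order of vanishing of `f · g` at `c` is the sum of the orders (Mathlib
`analyticOrderNatAt_mul`) and the LEADING TAYLOR COEFFICIENT `f^{(n)}(c)/n!` (`n` the order) of the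
product is the product of the leading coefficients (`leadCoeff_mul`, via the local factorisation
`f = (z - c)^n · φ`, `φ(c) = f^{(n)}(c)/n!`, `iteratedDeriv_pow_mul`; theorems only, no definitions). Consequence for an elliptic
curve `E/ℚ` and a quadratic field `K` of discriminant `D` (Artin formalism
`L(E_K, s) = L(E, s) · L(E^{(D)}, s)`, PROVED in the tree:
`WeierstrassCurve.LSeries_baseChange_quadratic_holds`, `hasEntireLFunction_baseChange_quadratic`):
`r_an(E_K) = r_an(E) + r_an(E^{(D)})` and `L^{(r_K)}(E_K,1)/r_K! = [L^{(r)}(E,1)/r!]·[L^{(r')}(E^{(D)},1)/r'!]`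
(`analyticRank_baseChange_quadratic`, `leadingLCoeff_baseChange_quadratic`), granted the entire
continuation of `L(E,s)` and `L(E^{(D)},s)` (modularity, the tree's named fact
`hasEntireLFunction_rat`, taken as the hypothesis `hmod` exactly as every class theorem of the cell
does). Elementary; [folklore] throughout (Ireland–Rosen, Prop. 20.5.4; Gross–Zagier 1986 I.§7
"orders of vanishing add").
-/

noncomputable section

open scoped Classical
open Filter Topology

namespace Summit.BirchSwinnertonDyer.Rank1Residual.AdditivePotMult

/-! ## §1 Leading Taylor coefficients of analytic functions -/

/-- `d^n/dz^n [(z - c)^n · g(z)] (c) = n! · g(c)` for `g` analytic at `c` (induction on `n`: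
the derivative of `(z-c)^{n+1} g` is `(z-c)^n · ((n+1) g + (z-c) g')` near `c`). [folklore] -/
theorem iteratedDeriv_pow_mul (n : ℕ) {g : ℂ → ℂ} {c : ℂ} (hg : AnalyticAt ℂ g c) :
    iteratedDeriv n (fun z => (z - c) ^ n * g z) c = (n.factorial : ℂ) * g c := by
  induction n generalizing g with
  | zero => simp
  | succ n ih =>
    -- the auxiliary analytic function `g₁ = (n+1) g + (z - c) g'`
    set g₁ : ℂ → ℂ := fun z => ((n : ℂ) + 1) * g z + (z - c) * deriv g z with hg₁_def
    have hg₁ : AnalyticAt ℂ g₁ c := by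
      have h1 : AnalyticAt ℂ (fun z => ((n : ℂ) + 1) * g z) c := analyticAt_const.mul hg
      have h2 : AnalyticAt ℂ (fun z => (z - c) * deriv g z) c :=
        (analyticAt_id.sub analyticAt_const).mul hg.deriv
      exact h1.add h2
    -- `deriv ((z-c)^{n+1} g) = (z-c)^n g₁` near `c`
    have hev : deriv (fun z => (z - c) ^ (n + 1) * g z) =ᶠ[𝓝 c] fun z => (z - c) ^ n * g₁ z := by
      filter_upwards [hg.eventually_analyticAt] with z hz
      have hd1 : HasDerivAt (fun w => (w - c) ^ (n + 1))
          (((n + 1 : ℕ) : ℂ) * (z - c) ^ (n + 1 - 1) * 1) z :=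
        ((hasDerivAt_id' z).sub_const c).fun_pow (n + 1)
      have hd2 : HasDerivAt g (deriv g z) z := hz.differentiableAt.hasDerivAt
      rw [show deriv (fun z => (z - c) ^ (n + 1) * g z) z = _ from (hd1.fun_mul hd2).deriv, hg₁_def]
      simp only [Nat.add_sub_cancel, Nat.cast_add, Nat.cast_one, mul_one]
      ring
    rw [iteratedDeriv_succ', Filter.EventuallyEq.iteratedDeriv_eq n hev, ih hg₁, hg₁_def]
    simp only [sub_self, zero_mul, add_zero, Nat.factorial_succ, Nat.cast_mul, Nat.cast_add,
      Nat.cast_one]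
    ring

/-- If `f = (z - c)^n · g` near `c` with `n` the order of vanishing of `f` and `g` analytic, then
`f^{(n)}(c) = n! · g(c)`. [folklore] -/
theorem iteratedDeriv_order_eq {f g : ℂ → ℂ} {c : ℂ} {n : ℕ} (hg : AnalyticAt ℂ g c)
    (hfg : f =ᶠ[𝓝 c] fun z => (z - c) ^ n • g z) :
    iteratedDeriv n f c = (n.factorial : ℂ) * g c := by
  have hfg' : f =ᶠ[𝓝 c] fun z => (z - c) ^ n * g z := by
    filter_upwards [hfg] with z hz
    rw [hz, smul_eq_mul]
  rw [Filter.EventuallyEq.iteratedDeriv_eq n hfg', iteratedDeriv_pow_mul n hg]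

/-- The leading Taylor coefficient `f^{(n)}(c)/n!` (`n` the order of vanishing) is the value
`g(c)` of the local factorisation `f = (z-c)^n · g`. [folklore] -/
theorem leadCoeff_eq_of_eventuallyEq {f g : ℂ → ℂ} {c : ℂ} (hg : AnalyticAt ℂ g c)
    (hfg : f =ᶠ[𝓝 c] fun z => (z - c) ^ analyticOrderNatAt f c • g z) :
    iteratedDeriv (analyticOrderNatAt f c) f c / ((analyticOrderNatAt f c).factorial : ℂ) = g c := by
  rw [iteratedDeriv_order_eq hg hfg, mul_div_cancel_left₀]
  exact_mod_cast (Nat.factorial_pos _).ne'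

/-- **Leading Taylor coefficients multiply.** For `f, g` analytic at `c`, each not identically
zero near `c`, with orders of vanishing `n, m` (so `f · g` has order `n + m`,
`analyticOrderNatAt_mul`): `(fg)^{(n+m)}(c)/(n+m)! = [f^{(n)}(c)/n!] · [g^{(m)}(c)/m!]`. [folklore] -/
theorem leadCoeff_mul {f g : ℂ → ℂ} {c : ℂ} (hf : AnalyticAt ℂ f c) (hg : AnalyticAt ℂ g c)
    (hf' : analyticOrderAt f c ≠ ⊤) (hg' : analyticOrderAt g c ≠ ⊤) :
    iteratedDeriv (analyticOrderNatAt (f * g) c) (f * g) c /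
        ((analyticOrderNatAt (f * g) c).factorial : ℂ) =
      (iteratedDeriv (analyticOrderNatAt f c) f c / ((analyticOrderNatAt f c).factorial : ℂ)) *
        (iteratedDeriv (analyticOrderNatAt g c) g c / ((analyticOrderNatAt g c).factorial : ℂ)) := by
  obtain ⟨φ, hφ, -, hfφ⟩ := hf.analyticOrderAt_ne_top.mp hf'
  obtain ⟨ψ, hψ, -, hgψ⟩ := hg.analyticOrderAt_ne_top.mp hg'
  have hord : analyticOrderNatAt (f * g) c = analyticOrderNatAt f c + analyticOrderNatAt g c :=
    analyticOrderNatAt_mul hf hg hf' hg'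
  have hprod : f * g =ᶠ[𝓝 c] fun z => (z - c) ^ analyticOrderNatAt (f * g) c • (φ z * ψ z) := by
    filter_upwards [hfφ, hgψ] with z hz hz'
    simp only [Pi.mul_apply, hz, hz', hord, smul_eq_mul, pow_add]
    ring
  rw [leadCoeff_eq_of_eventuallyEq (hφ.mul hψ) hprod, leadCoeff_eq_of_eventuallyEq hφ hfφ,
    leadCoeff_eq_of_eventuallyEq hψ hgψ]
  rfl

/-! ## §2 Application: `L^*(E_K, 1) = L^*(E, 1) · L^*(E^{(D)}, 1)` for a quadratic field `K` -/

open WeierstrassCurve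

variable (W : WeierstrassCurve ℚ) [W.IsElliptic] (K : Type) [Field K] [NumberField K]

/-- **Analytic ranks add under quadratic base change**: for `[K : ℚ] = 2` of discriminant `D`,
`r_an(E_K) = r_an(E) + r_an(E^{(D)})` (Artin formalism, proved in the tree, + Mathlib's
`analyticOrderNatAt_mul`), granted the entire continuations over `ℚ` (`hmod`). [folklore] -/
theorem analyticRank_baseChange_quadratic (hmod : hasEntireLFunction_rat)
    (h2 : Module.finrank ℚ K = 2) :
    (W.baseChange K).analyticRank =
      W.analyticRank + (W.quadraticTwist (NumberField.discr K : ℚ)).analyticRank := by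
  set Wt := W.quadraticTwist (NumberField.discr K : ℚ) with hWt
  have hD : (NumberField.discr K : ℚ) ≠ 0 := by exact_mod_cast NumberField.discr_ne_zero K
  haveI : Wt.IsElliptic := W.isElliptic_quadraticTwist hD
  obtain ⟨-, hprod⟩ := hasEntireLFunction_baseChange_quadratic LSeries_baseChange_quadratic_holds
    W K h2 (hmod W) (hmod Wt)
  have hfun : (W.baseChange K).entireLFunction = W.entireLFunction * Wt.entireLFunction :=
    funext fun s => by rw [hprod s, Pi.mul_apply]
  have hW : AnalyticAt ℂ W.entireLFunction 1 :=
    (W.differentiable_entireLFunction (hmod W)).analyticAt 1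
  have hWt : AnalyticAt ℂ Wt.entireLFunction 1 :=
    (Wt.differentiable_entireLFunction (hmod Wt)).analyticAt 1
  unfold analyticRank
  rw [hfun]
  exact analyticOrderNatAt_mul hW hWt (W.analyticOrderAt_entireLFunction_ne_top (hmod W))
    (Wt.analyticOrderAt_entireLFunction_ne_top (hmod Wt))

/-- **Leading coefficients multiply under quadratic base change**: for `[K : ℚ] = 2` of
discriminant `D`, `L^{(r_K)}(E_K,1)/r_K! = [L^{(r)}(E,1)/r!] · [L^{(r')}(E^{(D)},1)/r'!]`
(Artin formalism + `leadCoeff_mul`), granted `hmod`. [folklore] -/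
theorem leadingLCoeff_baseChange_quadratic (hmod : hasEntireLFunction_rat)
    (h2 : Module.finrank ℚ K = 2) :
    (W.baseChange K).leadingLCoeff =
      W.leadingLCoeff * (W.quadraticTwist (NumberField.discr K : ℚ)).leadingLCoeff := by
  set Wt := W.quadraticTwist (NumberField.discr K : ℚ) with hWt
  have hD : (NumberField.discr K : ℚ) ≠ 0 := by exact_mod_cast NumberField.discr_ne_zero K
  haveI : Wt.IsElliptic := W.isElliptic_quadraticTwist hD
  obtain ⟨-, hprod⟩ := hasEntireLFunction_baseChange_quadratic LSeries_baseChange_quadratic_holds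
    W K h2 (hmod W) (hmod Wt)
  have hfun : (W.baseChange K).entireLFunction = W.entireLFunction * Wt.entireLFunction :=
    funext fun s => by rw [hprod s, Pi.mul_apply]
  have hW : AnalyticAt ℂ W.entireLFunction 1 :=
    (W.differentiable_entireLFunction (hmod W)).analyticAt 1
  have hWt : AnalyticAt ℂ Wt.entireLFunction 1 :=
    (Wt.differentiable_entireLFunction (hmod Wt)).analyticAt 1
  unfold leadingLCoeff analyticRank
  rw [hfun]
  exact leadCoeff_mul hW hWt (W.analyticOrderAt_entireLFunction_ne_top (hmod W))
    (Wt.analyticOrderAt_entireLFunction_ne_top (hmod Wt))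

end Summit.BirchSwinnertonDyer.Rank1Residual.AdditivePotMult

end
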